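import Mathlib
import Summits.Ventures.PercRepro2.CoinKSureGate
import Summits.Ventures.PercRepro2.CoinChainLayerCakeLemmas

/-!
# The two-gate layer cake — the abstract theorem behind the coin-resolved AND-switch chain
(blind cell PercRepro2, night-2 g21; proofs/NIGHT2-DARC.md §61)

`R`-law `G` (log-supermodular on `U.powerset`), two gates `G₀` (coin closed) and `G₁` (coin open),
each log-supermodular and equal to `G` on the clusters missing `ent`, `G₁` Holley-above `G` from
every entered cluster (`wML`), weights `α, β ≥ 0`, increasing nonnegative markers `x, y`.  If the
combined gate `α G₀ + β G₁` has `x`-mean BELOW the `G`-mean (`hSx`) and the coin-closed gate `G₀`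
has `x`-mean ABOVE it (`hG0x`), the cleared functional of `(G, α G₀ + β G₁)` is nonnegative.

Proof: split by the entry state `W ∩ ent` and by the coin.  Within a state each gate is
log-supermodular (FKG, `within_state_bound`).  The between-state sum over the `(cluster, coin)`
pairs is the discrete layer cake of the `y`-state-means (`sum_mul_nonneg_of_levels`): its base
term is `≥ 0` because the bottom value is the ideal `y`-mean of `G` (below the global one,
`ideal_mean`) and `∑ c ≤ 0` is `hSx`; every level set is an up-set of states not containing the
ideal, and its level sum splits into the coin-open part — `G₁` on an entered up-set is
Holley-above `G` (`level_holley`) — and the coin-closed part — FKG of `G₀` on the up-set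
(`upset_mean`) followed by `hG0x`.  No sign condition on the `y`-shifts is needed.
-/

namespace Summit.Ventures.PercRepro2.Coin

open Classical

section LayerCakeAbstract

variable {V : Type*} [DecidableEq V] {R : Type*} [Field R] [LinearOrder R] [IsStrictOrderedRing R]

/-- **THE TWO-GATE LAYER CAKE.** `G` the `R`-law (log-supermodular), two gates `G₀, G₁` (each
log-supermodular, each equal to `G` on the clusters missing `ent`), `G₁` Holley-above `G` from
every entered cluster (`wML`), weights `α, β ≥ 0`; increasing nonnegative markers `x, y`.  If the
combined gate `α G₀ + β G₁` has `x`-mean below the `G`-mean (`hSx`) and `G₀` has `x`-mean above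
the `G`-mean (`hG0x`), the cleared functional of `(G, α G₀ + β G₁)` is nonnegative. -/
theorem twoGate_functional_nonneg (U ent : Finset V) (G G₀ G₁ x y : Finset V → R) (α β : R)
    (hα : 0 ≤ α) (hβ : 0 ≤ β)
    (hG : ∀ W, 0 ≤ G W) (hG₀ : ∀ W, 0 ≤ G₀ W) (hG₁ : ∀ W, 0 ≤ G₁ W)
    (hx0 : ∀ W, 0 ≤ x W) (hy0 : ∀ W, 0 ≤ y W)
    (hxm : ∀ s t, x s ≤ x (s ∪ t)) (hym : ∀ s t, y s ≤ y (s ∪ t))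
    (wLL : ∀ s ⊆ U, ∀ t ⊆ U, G s * G t ≤ G (s ∩ t) * G (s ∪ t))
    (w00 : ∀ s ⊆ U, ∀ t ⊆ U, G₀ s * G₀ t ≤ G₀ (s ∩ t) * G₀ (s ∪ t))
    (w11 : ∀ s ⊆ U, ∀ t ⊆ U, G₁ s * G₁ t ≤ G₁ (s ∩ t) * G₁ (s ∪ t))
    (wML : ∀ s ⊆ U, ∀ t ⊆ U, (∃ r ∈ ent, r ∈ s) → G₁ s * G t ≤ G (s ∩ t) * G₁ (s ∪ t))
    (hI0 : ∀ W, W ∩ ent = ∅ → G₀ W = G W) (hI1 : ∀ W, W ∩ ent = ∅ → G₁ W = G W)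
    (hSx : (∑ W ∈ U.powerset, (α * G₀ W + β * G₁ W) * x W) * (∑ W ∈ U.powerset, G W) ≤
        (∑ W ∈ U.powerset, (α * G₀ W + β * G₁ W)) * (∑ W ∈ U.powerset, G W * x W))
    (hG0x : (∑ W ∈ U.powerset, G₀ W) * (∑ W ∈ U.powerset, G W * x W) ≤
        (∑ W ∈ U.powerset, G₀ W * x W) * (∑ W ∈ U.powerset, G W)) :
    0 ≤ (∑ W ∈ U.powerset, G W) ^ 2 *
          (∑ W ∈ U.powerset, (α * G₀ W + β * G₁ W) * (x W * y W))
        - (∑ W ∈ U.powerset, G W) * (∑ W ∈ U.powerset, G W * x W) *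
          (∑ W ∈ U.powerset, (α * G₀ W + β * G₁ W) * y W)
        - (∑ W ∈ U.powerset, G W) * (∑ W ∈ U.powerset, G W * y W) *
          (∑ W ∈ U.powerset, (α * G₀ W + β * G₁ W) * x W)
        + (∑ W ∈ U.powerset, G W * x W) * (∑ W ∈ U.powerset, G W * y W) *
          (∑ W ∈ U.powerset, (α * G₀ W + β * G₁ W)) := by
  -- the `R`-law totals
  set Λ := ∑ W ∈ U.powerset, G W with hΛ
  set Λ₁ := ∑ W ∈ U.powerset, G W * x W with hΛ₁
  set Λ₂ := ∑ W ∈ U.powerset, G W * y W with hΛ₂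
  have hΛ0 : 0 ≤ Λ := Finset.sum_nonneg fun W _ => hG W
  have hΛ₂0 : 0 ≤ Λ₂ := Finset.sum_nonneg fun W _ => mul_nonneg (hG W) (hy0 W)
  -- the target as a centred sum over the combined gate, split by the coin
  have hsplit : (∑ W ∈ U.powerset, (α * G₀ W + β * G₁ W) * ((Λ * x W - Λ₁) * (Λ * y W - Λ₂))) =
      α * (∑ W ∈ U.powerset, G₀ W * ((Λ * x W - Λ₁) * (Λ * y W - Λ₂))) +
        β * (∑ W ∈ U.powerset, G₁ W * ((Λ * x W - Λ₁) * (Λ * y W - Λ₂))) := by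
    rw [Finset.mul_sum, Finset.mul_sum, ← Finset.sum_add_distrib]
    exact Finset.sum_congr rfl fun W _ => by ring
  have htarget : (∑ W ∈ U.powerset, G W) ^ 2 *
          (∑ W ∈ U.powerset, (α * G₀ W + β * G₁ W) * (x W * y W))
        - (∑ W ∈ U.powerset, G W) * (∑ W ∈ U.powerset, G W * x W) *
          (∑ W ∈ U.powerset, (α * G₀ W + β * G₁ W) * y W)
        - (∑ W ∈ U.powerset, G W) * (∑ W ∈ U.powerset, G W * y W) *
          (∑ W ∈ U.powerset, (α * G₀ W + β * G₁ W) * x W)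
        + (∑ W ∈ U.powerset, G W * x W) * (∑ W ∈ U.powerset, G W * y W) *
          (∑ W ∈ U.powerset, (α * G₀ W + β * G₁ W)) =
      ∑ W ∈ U.powerset, (α * G₀ W + β * G₁ W) * ((Λ * x W - Λ₁) * (Λ * y W - Λ₂)) := by
    rw [expand_centred, ← hΛ, ← hΛ₁, ← hΛ₂]; ring
  rw [htarget, hsplit]
  clear_value Λ Λ₁ Λ₂
  -- state masses and means of the two gates and of the `R`-law
  set N₀ : Finset V → R := fun e => ∑ W ∈ U.powerset.filter (fun W => W ∩ ent = e), G₀ W with hN₀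
  set Nx₀ : Finset V → R :=
    fun e => ∑ W ∈ U.powerset.filter (fun W => W ∩ ent = e), G₀ W * x W with hNx₀
  set Ny₀ : Finset V → R :=
    fun e => ∑ W ∈ U.powerset.filter (fun W => W ∩ ent = e), G₀ W * y W with hNy₀
  set N₁ : Finset V → R := fun e => ∑ W ∈ U.powerset.filter (fun W => W ∩ ent = e), G₁ W with hN₁
  set Nx₁ : Finset V → R :=
    fun e => ∑ W ∈ U.powerset.filter (fun W => W ∩ ent = e), G₁ W * x W with hNx₁
  set Ny₁ : Finset V → R :=
    fun e => ∑ W ∈ U.powerset.filter (fun W => W ∩ ent = e), G₁ W * y W with hNy₁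
  set NG : R := ∑ W ∈ U.powerset.filter (fun W => W ∩ ent = ∅), G W with hNG
  set NyG : R := ∑ W ∈ U.powerset.filter (fun W => W ∩ ent = ∅), G W * y W with hNyG
  have hN₀0 : ∀ e, 0 ≤ N₀ e := fun e => Finset.sum_nonneg fun W _ => hG₀ W
  have hN₁0 : ∀ e, 0 ≤ N₁ e := fun e => Finset.sum_nonneg fun W _ => hG₁ W
  have hNx₀0 : ∀ e, 0 ≤ Nx₀ e := fun e => Finset.sum_nonneg fun W _ => mul_nonneg (hG₀ W) (hx0 W)
  have hNx₁0 : ∀ e, 0 ≤ Nx₁ e := fun e => Finset.sum_nonneg fun W _ => mul_nonneg (hG₁ W) (hx0 W)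
  have hNy₀0 : ∀ e, 0 ≤ Ny₀ e := fun e => Finset.sum_nonneg fun W _ => mul_nonneg (hG₀ W) (hy0 W)
  have hNy₁0 : ∀ e, 0 ≤ Ny₁ e := fun e => Finset.sum_nonneg fun W _ => mul_nonneg (hG₁ W) (hy0 W)
  have hNG0 : 0 ≤ NG := Finset.sum_nonneg fun W _ => hG W
  set Xb₀ : Finset V → R := fun W => Nx₀ (W ∩ ent) / N₀ (W ∩ ent) with hXb₀
  set Yb₀ : Finset V → R := fun W => Ny₀ (W ∩ ent) / N₀ (W ∩ ent) with hYb₀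
  set Xb₁ : Finset V → R := fun W => Nx₁ (W ∩ ent) / N₁ (W ∩ ent) with hXb₁
  set Yb₁ : Finset V → R := fun W => Ny₁ (W ∩ ent) / N₁ (W ∩ ent) with hYb₁
  have hXb₀0 : ∀ W, 0 ≤ Xb₀ W := fun W => div_nonneg (hNx₀0 _) (hN₀0 _)
  have hYb₀0 : ∀ W, 0 ≤ Yb₀ W := fun W => div_nonneg (hNy₀0 _) (hN₀0 _)
  have hXb₁0 : ∀ W, 0 ≤ Xb₁ W := fun W => div_nonneg (hNx₁0 _) (hN₁0 _)
  have hYb₁0 : ∀ W, 0 ≤ Yb₁ W := fun W => div_nonneg (hNy₁0 _) (hN₁0 _)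
  -- within-state FKG for each gate
  have hwithin₀ := within_state_bound U ent G₀ x y Λ Λ₁ Λ₂ hΛ0 hG₀ hx0 hy0 hxm hym w00
  have hwithin₁ := within_state_bound U ent G₁ x y Λ Λ₁ Λ₂ hΛ0 hG₁ hx0 hy0 hxm hym w11
  -- the ideal fibres of the two gates are those of the `R`-law
  have hN₀I : N₀ ∅ = NG := Finset.sum_congr rfl fun W hW => hI0 W (Finset.mem_filter.mp hW).2
  have hN₁I : N₁ ∅ = NG := Finset.sum_congr rfl fun W hW => hI1 W (Finset.mem_filter.mp hW).2
  have hNy₀I : Ny₀ ∅ = NyG :=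
    Finset.sum_congr rfl fun W hW => by rw [hI0 W (Finset.mem_filter.mp hW).2]
  have hNy₁I : Ny₁ ∅ = NyG :=
    Finset.sum_congr rfl fun W hW => by rw [hI1 W (Finset.mem_filter.mp hW).2]
  -- the state mass of a cluster in the support is positive
  have hNpos₀ : ∀ s ⊆ U, G₀ s ≠ 0 → 0 < N₀ (s ∩ ent) := by
    intro s hs hs0
    have h1 : 0 < G₀ s := lt_of_le_of_ne (hG₀ s) (Ne.symm hs0)
    have h2 : G₀ s ≤ N₀ (s ∩ ent) :=
      Finset.single_le_sum (f := G₀) (fun W _ => hG₀ W)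
        (Finset.mem_filter.mpr ⟨Finset.mem_powerset.mpr hs, rfl⟩)
    exact lt_of_lt_of_le h1 h2
  have hNpos₁ : ∀ s ⊆ U, G₁ s ≠ 0 → 0 < N₁ (s ∩ ent) := by
    intro s hs hs0
    have h1 : 0 < G₁ s := lt_of_le_of_ne (hG₁ s) (Ne.symm hs0)
    have h2 : G₁ s ≤ N₁ (s ∩ ent) :=
      Finset.single_le_sum (f := G₁) (fun W _ => hG₁ W)
        (Finset.mem_filter.mpr ⟨Finset.mem_powerset.mpr hs, rfl⟩)
    exact lt_of_lt_of_le h1 h2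
  -- joins stay in the support
  have hjoin₀ : ∀ s ⊆ U, ∀ t ⊆ U, G₀ s ≠ 0 → G₀ t ≠ 0 → G₀ (s ∪ t) ≠ 0 := by
    intro s hs t ht hs0 ht0 hu
    have h1 : 0 < G₀ s * G₀ t :=
      mul_pos (lt_of_le_of_ne (hG₀ s) (Ne.symm hs0)) (lt_of_le_of_ne (hG₀ t) (Ne.symm ht0))
    have h2 := w00 s hs t ht
    rw [hu, mul_zero] at h2
    exact absurd (lt_of_lt_of_le h1 h2) (lt_irrefl 0)
  have hjoin₁ : ∀ s ⊆ U, ∀ t ⊆ U, (∃ r ∈ ent, r ∈ s) → G₁ s ≠ 0 → G t ≠ 0 →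
      G₁ (s ∪ t) ≠ 0 := by
    intro s hs t ht hent hs0 ht0 hu
    have h1 : 0 < G₁ s * G t :=
      mul_pos (lt_of_le_of_ne (hG₁ s) (Ne.symm hs0)) (lt_of_le_of_ne (hG t) (Ne.symm ht0))
    have h2 := wML s hs t ht hent
    rw [hu, mul_zero] at h2
    exact absurd (lt_of_lt_of_le h1 h2) (lt_irrefl 0)
  -- the state means are increasing on the support
  have hYb₀_mono : ∀ s ⊆ U, ∀ t ⊆ U, G₀ s ≠ 0 → G₀ (s ∪ t) ≠ 0 → Yb₀ s ≤ Yb₀ (s ∪ t) := by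
    intro s hs t ht hs0 hu0
    have hee : s ∩ ent ⊆ (s ∪ t) ∩ ent :=
      Finset.inter_subset_inter Finset.subset_union_left (Finset.Subset.refl _)
    have hNs := hNpos₀ s hs hs0
    have hNu := hNpos₀ (s ∪ t) (Finset.union_subset hs ht) hu0
    have key : Ny₀ (s ∩ ent) * N₀ ((s ∪ t) ∩ ent) ≤ N₀ (s ∩ ent) * Ny₀ ((s ∪ t) ∩ ent) :=
      fiber_holley U ent (s ∩ ent) ((s ∪ t) ∩ ent) G₀ y hG₀ hy0 hym w00 hee
    show Ny₀ (s ∩ ent) / N₀ (s ∩ ent) ≤ Ny₀ ((s ∪ t) ∩ ent) / N₀ ((s ∪ t) ∩ ent)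
    rw [div_le_div_iff₀ hNs hNu]
    linarith [key]
  have hYb₁_mono : ∀ s ⊆ U, ∀ t ⊆ U, G₁ s ≠ 0 → G₁ (s ∪ t) ≠ 0 → Yb₁ s ≤ Yb₁ (s ∪ t) := by
    intro s hs t ht hs0 hu0
    have hee : s ∩ ent ⊆ (s ∪ t) ∩ ent :=
      Finset.inter_subset_inter Finset.subset_union_left (Finset.Subset.refl _)
    have hNs := hNpos₁ s hs hs0
    have hNu := hNpos₁ (s ∪ t) (Finset.union_subset hs ht) hu0
    have key : Ny₁ (s ∩ ent) * N₁ ((s ∪ t) ∩ ent) ≤ N₁ (s ∩ ent) * Ny₁ ((s ∪ t) ∩ ent) :=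
      fiber_holley U ent (s ∩ ent) ((s ∪ t) ∩ ent) G₁ y hG₁ hy0 hym w11 hee
    show Ny₁ (s ∩ ent) / N₁ (s ∩ ent) ≤ Ny₁ ((s ∪ t) ∩ ent) / N₁ ((s ∪ t) ∩ ent)
    rw [div_le_div_iff₀ hNs hNu]
    linarith [key]
  -- the bottom value: the ideal `y`-mean of the `R`-law, below the global `R`-mean
  set w₀ : R := Λ * (NyG / NG) - Λ₂ with hw₀def
  have hw₀ : w₀ ≤ 0 := by
    by_cases h : NG = 0
    · simp only [hw₀def, h, div_zero, mul_zero]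
      linarith
    · have hpos : 0 < NG := lt_of_le_of_ne hNG0 (Ne.symm h)
      have key : NyG * Λ ≤ NG * Λ₂ := by
        rw [hNyG, hNG, hΛ, hΛ₂]; exact ideal_mean U ent G y hG hy0 hym wLL
      have : Λ * (NyG / NG) ≤ Λ₂ := by
        rw [mul_div_assoc', div_le_iff₀ hpos]; linarith [key]
      simp only [hw₀def]; linarith
  -- every state mean of a gate on its support is above the bottom value
  have hlow₀ : ∀ W ∈ U.powerset, G₀ W ≠ 0 → w₀ ≤ Λ * Yb₀ W - Λ₂ := by
    intro W hW hW0
    have hWU : W ⊆ U := Finset.mem_powerset.mp hW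
    have hle : NyG / NG ≤ Yb₀ W := by
      by_cases h : NG = 0
      · rw [h, div_zero]; exact hYb₀0 W
      · have hpos : 0 < NG := lt_of_le_of_ne hNG0 (Ne.symm h)
        have hNW := hNpos₀ W hWU hW0
        have key : Ny₀ ∅ * N₀ (W ∩ ent) ≤ N₀ ∅ * Ny₀ (W ∩ ent) :=
          fiber_holley U ent ∅ (W ∩ ent) G₀ y hG₀ hy0 hym w00 (Finset.empty_subset _)
        rw [hN₀I, hNy₀I] at key
        show NyG / NG ≤ Ny₀ (W ∩ ent) / N₀ (W ∩ ent)
        rw [div_le_div_iff₀ hpos hNW]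
        linarith [key]
    have := mul_le_mul_of_nonneg_left hle hΛ0
    simp only [hw₀def]; linarith
  have hlow₁ : ∀ W ∈ U.powerset, G₁ W ≠ 0 → w₀ ≤ Λ * Yb₁ W - Λ₂ := by
    intro W hW hW0
    have hWU : W ⊆ U := Finset.mem_powerset.mp hW
    have hle : NyG / NG ≤ Yb₁ W := by
      by_cases h : NG = 0
      · rw [h, div_zero]; exact hYb₁0 W
      · have hpos : 0 < NG := lt_of_le_of_ne hNG0 (Ne.symm h)
        have hNW := hNpos₁ W hWU hW0
        have key : Ny₁ ∅ * N₁ (W ∩ ent) ≤ N₁ ∅ * Ny₁ (W ∩ ent) :=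
          fiber_holley U ent ∅ (W ∩ ent) G₁ y hG₁ hy0 hym w11 (Finset.empty_subset _)
        rw [hN₁I, hNy₁I] at key
        show NyG / NG ≤ Ny₁ (W ∩ ent) / N₁ (W ∩ ent)
        rw [div_le_div_iff₀ hpos hNW]
        linarith [key]
    have := mul_le_mul_of_nonneg_left hle hΛ0
    simp only [hw₀def]; linarith
  -- the level sums, coin OPEN: `G₁` on an entered up-set is Holley-above the `R`-law
  have hlev₁ : ∀ t, w₀ < t →
      0 ≤ ∑ W ∈ U.powerset.filter (fun W => t ≤ Λ * Yb₁ W - Λ₂), G₁ W * (Λ * Xb₁ W - Λ₁) := by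
    intro t ht
    have hP : ∀ s ⊆ U, ∀ t' ⊆ U, t ≤ Λ * Yb₁ s - Λ₂ → G₁ s ≠ 0 → G t' ≠ 0 →
        t ≤ Λ * Yb₁ (s ∪ t') - Λ₂ ∧ (∃ r ∈ ent, r ∈ s) := by
      intro s hs t' ht' hPs hs0 ht'0
      have hent : ∃ r ∈ ent, r ∈ s := by
        by_contra hno
        have hse : s ∩ ent = ∅ := by
          rw [Finset.eq_empty_iff_forall_notMem]
          intro r hr
          rw [Finset.mem_inter] at hr
          exact hno ⟨r, hr.2, hr.1⟩
        have hYs : Yb₁ s = NyG / NG := by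
          show Ny₁ (s ∩ ent) / N₁ (s ∩ ent) = NyG / NG
          rw [hse, hN₁I, hNy₁I]
        rw [hYs] at hPs
        simp only [hw₀def] at ht
        linarith
      refine ⟨?_, hent⟩
      have hu0 := hjoin₁ s hs t' ht' hent hs0 ht'0
      have hmono := hYb₁_mono s hs t' ht' hs0 hu0
      have := mul_le_mul_of_nonneg_left hmono hΛ0
      linarith
    have key := level_holley U ent G G₁ x hG hG₁ hx0 hxm wML (fun W => t ≤ Λ * Yb₁ W - Λ₂) hP
    rw [← hΛ, ← hΛ₁] at key
    have hmean : (∑ W ∈ U.powerset.filter (fun W => t ≤ Λ * Yb₁ W - Λ₂), G₁ W * Xb₁ W) =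
        ∑ W ∈ U.powerset.filter (fun W => t ≤ Λ * Yb₁ W - Λ₂), G₁ W * x W :=
      sum_fiber_mean U ent G₁ x hG₁ (fun e => t ≤ Λ * (Ny₁ e / N₁ e) - Λ₂)
    have hexp : (∑ W ∈ U.powerset.filter (fun W => t ≤ Λ * Yb₁ W - Λ₂), G₁ W * (Λ * Xb₁ W - Λ₁)) =
        Λ * (∑ W ∈ U.powerset.filter (fun W => t ≤ Λ * Yb₁ W - Λ₂), G₁ W * Xb₁ W) -
          Λ₁ * (∑ W ∈ U.powerset.filter (fun W => t ≤ Λ * Yb₁ W - Λ₂), G₁ W) := by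
      rw [Finset.mul_sum, Finset.mul_sum, ← Finset.sum_sub_distrib]
      exact Finset.sum_congr rfl fun W _ => by ring
    rw [hexp, hmean]
    linarith [key]
  -- the level sums, coin CLOSED: FKG of `G₀` on the up-set, then `hG0x`
  have hlev₀ : ∀ t, w₀ < t →
      0 ≤ ∑ W ∈ U.powerset.filter (fun W => t ≤ Λ * Yb₀ W - Λ₂), G₀ W * (Λ * Xb₀ W - Λ₁) := by
    intro t ht
    have hP : ∀ s ⊆ U, ∀ t' ⊆ U, t ≤ Λ * Yb₀ s - Λ₂ → G₀ s ≠ 0 → G₀ t' ≠ 0 →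
        t ≤ Λ * Yb₀ (s ∪ t') - Λ₂ := by
      intro s hs t' ht' hPs hs0 ht'0
      have hu0 := hjoin₀ s hs t' ht' hs0 ht'0
      have hmono := hYb₀_mono s hs t' ht' hs0 hu0
      have := mul_le_mul_of_nonneg_left hmono hΛ0
      linarith
    have key := upset_mean U G₀ x hG₀ hx0 hxm w00 (fun W => t ≤ Λ * Yb₀ W - Λ₂) hP
    have hmean : (∑ W ∈ U.powerset.filter (fun W => t ≤ Λ * Yb₀ W - Λ₂), G₀ W * Xb₀ W) =
        ∑ W ∈ U.powerset.filter (fun W => t ≤ Λ * Yb₀ W - Λ₂), G₀ W * x W :=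
      sum_fiber_mean U ent G₀ x hG₀ (fun e => t ≤ Λ * (Ny₀ e / N₀ e) - Λ₂)
    have hexp : (∑ W ∈ U.powerset.filter (fun W => t ≤ Λ * Yb₀ W - Λ₂), G₀ W * (Λ * Xb₀ W - Λ₁)) =
        Λ * (∑ W ∈ U.powerset.filter (fun W => t ≤ Λ * Yb₀ W - Λ₂), G₀ W * Xb₀ W) -
          Λ₁ * (∑ W ∈ U.powerset.filter (fun W => t ≤ Λ * Yb₀ W - Λ₂), G₀ W) := by
      rw [Finset.mul_sum, Finset.mul_sum, ← Finset.sum_sub_distrib]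
      exact Finset.sum_congr rfl fun W _ => by ring
    rw [hexp, hmean]
    -- `(∑ G₀) · (Λ₁ · ∑_P G₀ − Λ · ∑_P G₀ x) ≤ 0`
    have hS00 : 0 ≤ ∑ W ∈ U.powerset, G₀ W := Finset.sum_nonneg fun W _ => hG₀ W
    have hSP0 : 0 ≤ ∑ W ∈ U.powerset.filter (fun W => t ≤ Λ * Yb₀ W - Λ₂), G₀ W :=
      Finset.sum_nonneg fun W _ => hG₀ W
    by_cases hz : (∑ W ∈ U.powerset, G₀ W) = 0
    · -- the gate vanishes: both level sums are zero
      have hall : ∀ W ∈ U.powerset, G₀ W = 0 := fun W hW =>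
        (Finset.sum_eq_zero_iff_of_nonneg (fun W _ => hG₀ W)).mp hz W hW
      have h1 : (∑ W ∈ U.powerset.filter (fun W => t ≤ Λ * Yb₀ W - Λ₂), G₀ W) = 0 :=
        Finset.sum_eq_zero fun W hW => hall W (Finset.mem_filter.mp hW).1
      have h2 : (∑ W ∈ U.powerset.filter (fun W => t ≤ Λ * Yb₀ W - Λ₂), G₀ W * x W) = 0 :=
        Finset.sum_eq_zero fun W hW => by rw [hall W (Finset.mem_filter.mp hW).1, zero_mul]
      rw [h1, h2]; simp
    · have hpos : 0 < ∑ W ∈ U.powerset, G₀ W := lt_of_le_of_ne hS00 (Ne.symm hz)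
      have h1 := mul_le_mul_of_nonneg_left hG0x hSP0
      have h2 := mul_le_mul_of_nonneg_right key hΛ0
      generalize hA : (∑ W ∈ U.powerset, G₀ W) = A at h1 h2 hpos ⊢
      generalize hB : (∑ W ∈ U.powerset, G₀ W * x W) = B at h1 h2 ⊢
      generalize hC : (∑ W ∈ U.powerset.filter (fun W => t ≤ Λ * Yb₀ W - Λ₂), G₀ W) = C at h1 h2 ⊢
      generalize hD : (∑ W ∈ U.powerset.filter (fun W => t ≤ Λ * Yb₀ W - Λ₂), G₀ W * x W) = D
        at h1 h2 ⊢
      have h5 : A * (Λ₁ * C) ≤ A * (Λ * D) := by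
        calc A * (Λ₁ * C) = C * (A * Λ₁) := by ring
          _ ≤ C * (B * Λ) := h1
          _ = C * B * Λ := by ring
          _ ≤ A * D * Λ := h2
          _ = A * (Λ * D) := by ring
      have h6 := le_of_mul_le_mul_left h5 hpos
      linarith
  -- the combined layer cake over the (cluster, coin) pairs
  set S : Finset (Finset V × Bool) := U.powerset ×ˢ (Finset.univ : Finset Bool) with hS
  set cc : Finset V × Bool → R := fun p =>
    if p.2 then β * (G₁ p.1 * (Λ * Xb₁ p.1 - Λ₁)) else α * (G₀ p.1 * (Λ * Xb₀ p.1 - Λ₁)) with hcc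
  set ww : Finset V × Bool → R := fun p =>
    if p.2 then Λ * Yb₁ p.1 - Λ₂ else Λ * Yb₀ p.1 - Λ₂ with hww
  have hsumS : ∀ f : Finset V × Bool → R,
      (∑ p ∈ S, f p) = (∑ W ∈ U.powerset, f (W, true)) + ∑ W ∈ U.powerset, f (W, false) := by
    intro f
    rw [hS, Finset.sum_product, ← Finset.sum_add_distrib]
    exact Finset.sum_congr rfl fun W _ => by rw [Fintype.sum_bool]
  have hB : (∑ p ∈ S, cc p * ww p) =
      β * (∑ W ∈ U.powerset, G₁ W * ((Λ * Xb₁ W - Λ₁) * (Λ * Yb₁ W - Λ₂))) +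
        α * (∑ W ∈ U.powerset, G₀ W * ((Λ * Xb₀ W - Λ₁) * (Λ * Yb₀ W - Λ₂))) := by
    rw [hsumS, Finset.mul_sum, Finset.mul_sum]
    congr 1 <;> exact Finset.sum_congr rfl fun W _ => by
      simp only [hcc, hww, Bool.false_eq_true, if_true, if_false]; ring
  have hlayer : 0 ≤ ∑ p ∈ S, cc p * ww p := by
    refine sum_mul_nonneg_of_levels S cc ww w₀ ?_ ?_ ?_
    · -- `w ≥ w₀` on the support of `c`
      rintro ⟨W, b⟩ hp hc
      have hW : W ∈ U.powerset := (Finset.mem_product.mp hp).1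
      cases b
      · simp only [hcc, hww, Bool.false_eq_true, if_false] at hc ⊢
        have hG0W : G₀ W ≠ 0 := by
          intro h0; apply hc; rw [h0, zero_mul, mul_zero]
        exact hlow₀ W hW hG0W
      · simp only [hcc, hww, if_true] at hc ⊢
        have hG1W : G₁ W ≠ 0 := by
          intro h0; apply hc; rw [h0, zero_mul, mul_zero]
        exact hlow₁ W hW hG1W
    · -- the base term: `w₀ ≤ 0` and `∑ c ≤ 0` (the gate lowers the `x`-mean)
      have hsum : (∑ p ∈ S, cc p) =
          Λ * (∑ W ∈ U.powerset, (α * G₀ W + β * G₁ W) * x W) -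
            Λ₁ * (∑ W ∈ U.powerset, (α * G₀ W + β * G₁ W)) := by
        rw [hsumS]
        have e1 : (∑ W ∈ U.powerset, cc (W, true)) =
            β * (Λ * (∑ W ∈ U.powerset, G₁ W * Xb₁ W) - Λ₁ * (∑ W ∈ U.powerset, G₁ W)) := by
          rw [Finset.mul_sum, Finset.mul_sum, ← Finset.sum_sub_distrib, Finset.mul_sum]
          exact Finset.sum_congr rfl fun W _ => by simp only [hcc, if_true]; ring
        have e0 : (∑ W ∈ U.powerset, cc (W, false)) =
            α * (Λ * (∑ W ∈ U.powerset, G₀ W * Xb₀ W) - Λ₁ * (∑ W ∈ U.powerset, G₀ W)) := by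
          rw [Finset.mul_sum, Finset.mul_sum, ← Finset.sum_sub_distrib, Finset.mul_sum]
          exact Finset.sum_congr rfl fun W _ => by
            simp only [hcc, Bool.false_eq_true, if_false]; ring
        rw [e1, e0, sum_mean_eq U ent G₁ x hG₁, sum_mean_eq U ent G₀ x hG₀]
        have e2 : (∑ W ∈ U.powerset, (α * G₀ W + β * G₁ W) * x W) =
            α * (∑ W ∈ U.powerset, G₀ W * x W) + β * (∑ W ∈ U.powerset, G₁ W * x W) := by
          rw [Finset.mul_sum, Finset.mul_sum, ← Finset.sum_add_distrib]
          exact Finset.sum_congr rfl fun W _ => by ring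
        have e3 : (∑ W ∈ U.powerset, (α * G₀ W + β * G₁ W)) =
            α * (∑ W ∈ U.powerset, G₀ W) + β * (∑ W ∈ U.powerset, G₁ W) := by
          rw [Finset.mul_sum, Finset.mul_sum, ← Finset.sum_add_distrib]
        rw [e2, e3]; ring
      rw [hsum]
      have : Λ * (∑ W ∈ U.powerset, (α * G₀ W + β * G₁ W) * x W) -
          Λ₁ * (∑ W ∈ U.powerset, (α * G₀ W + β * G₁ W)) ≤ 0 := by linarith [hSx]
      exact mul_nonneg_of_nonpos_of_nonpos hw₀ this
    · -- the level sums
      intro t ht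
      have hfilt : (∑ p ∈ S.filter (fun p => t ≤ ww p), cc p) =
          (∑ W ∈ U.powerset.filter (fun W => t ≤ Λ * Yb₁ W - Λ₂),
            β * (G₁ W * (Λ * Xb₁ W - Λ₁))) +
          ∑ W ∈ U.powerset.filter (fun W => t ≤ Λ * Yb₀ W - Λ₂),
            α * (G₀ W * (Λ * Xb₀ W - Λ₁)) := by
        rw [Finset.sum_filter, hsumS, Finset.sum_filter, Finset.sum_filter]
        congr 1
      rw [hfilt, ← Finset.mul_sum, ← Finset.mul_sum]
      exact add_nonneg (mul_nonneg hβ (hlev₁ t ht)) (mul_nonneg hα (hlev₀ t ht))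
  -- assemble
  rw [hB] at hlayer
  have h0 := mul_le_mul_of_nonneg_left hwithin₀ hα
  have h1 := mul_le_mul_of_nonneg_left hwithin₁ hβ
  linarith

end LayerCakeAbstract

end Summit.Ventures.PercRepro2.Coin
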